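import Literature.Combinatorics.Additive.ForgetfulCoupling
import Literature.Combinatorics.Additive.ProductSpaceLevelInequality
import Literature.Combinatorics.Additive.GlobalLevelInequalityBiglobal
import HarnessLib

/-!
# Biglobalness is preserved by the coupling, and juntas of pure degree `d` (Keevash–Lifshitz 2023, Lemmas 2.6/2.7, §2.3–2.4)

Source: P. Keevash, N. Lifshitz, *Sharp hypercontractivity for symmetric groups and its applications*,
arXiv:2307.15030 [KeevashLifshitz2023], §2.2 "Globalness is preserved" (Lemmas 2.6, 2.7), §2.3 (the
associated junta `f̃`, eq. (4.1)), §2.4 (the junta `g` on `[n]_d`); held text `paper:arxiv-2307.15030`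
pp. 13–14 read first-hand (cell pnp-psdrank, lit g20, 2026-08-27).

Fifth brick of the programme (cell memo LIT-26, Milestone M). It connects the `S_n` side of the tree
(`SnSpace`, `degLE`, `umvirate`, `IsBiglobal` of `GlobalLevelInequality(Biglobal).lean`), the coupling
(`ForgetfulCoupling.lean`) and the `[n]^n` side (`ProductSpaceLevelInequality.lean`):

* `transfer f (x) = n^n Σ_σ C(σ,x) f(σ)` — the paper's `T_C f` (conditional expectation of `f` given `x`,
  in the uniform normalisation);
* **Lemma 2.7** `isBiglobalX_transfer`: if `f` is `(r, γ₁, γ₂, d)`-biglobal on `S_n` (tree `IsBiglobal`,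
  `r ≥ 1`, `γ₁ ≥ 0`) then `T_C f` is `(r, γ₁, γ₂, d)`-biglobal on `[n]^n` (`ProductSpace.IsBiglobalX`).
  Printed proof (Lemma 2.6): the law of `σ ∼ N(a,b)` averaged over the free coordinates `b` is a mixture of
  uniform measures on umvirates; formalised as: the cylinder mass `μ(σ) = Σ_{x ∈ cyl(S,y)} C(σ,x)` is
  invariant under left multiplication by the pointwise stabiliser `G` of the values `y(S)`
  (`cylMass_lmul`), averaging over `G` turns `Σ_σ |f σ| μ(σ)` into an average of `|f|` over the orbits
  `G·σ`, which are umvirates `U_{σ⁻¹J → J}` on the DISTINCT values `J` of `y|_S`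
  (`sum_stabVal_mul_eq_sum_umvirate`), where biglobalness applies with `t' = |y(S)| ≤ |S|` (hence `r ≥ 1`);
  the `L²` half uses Cauchy–Schwarz for the probability weights `C(σ,x)/Σ_σ C(σ,x)`, `Σ_σ C(σ,x) = n^{−n}`;
* RIGHT TRANSLATES: `rshift τ f (σ) = f(στ)`; umvirates go to umvirates, so biglobalness is preserved
  (`isBiglobal_rshift`, "clearly `R_σ f` has the same biglobalness as `f`", proof of Lemma 3.6);
* JUNTAS OF PURE DEGREE `d` (§2.3–2.4): for positions `ι : Fin d ↪ Fin n`, a function `F` on `S_n` that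
  depends only on `σ∘ι` is `Coupling.liftFun ι g` for `g = juntaFun ι F` on `[n]_d`
  (`liftFun_juntaFun`); if moreover `F` sums to zero on every `(d−1)`-umvirate (i.e. `F ⊥ V_{≤ d−1}`) then `g`
  has pure top degree (`isPureTop_juntaFun`: a line of `[n]_d` lifts to a `(d−1)`-umvirate); the
  associated `[n]^n`-junta `f̃ = Coupling.liftFunX ι g` lies in `degLEX n n d` (`vecX_liftFunX_mem_degLEX`)
  and `‖f̃‖² · n! ≤ n^n · Σ_σ F(σ)²` (`norm_liftFunX_sq_le`, the paper's "`‖f̃‖ ≤ ‖f‖`");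
* COUNTING THE GOOD TRANSLATES (§2.3: "`P_τ(τ(T) ⊂ [n/4, n/2]) ≥ ½ 4^{−d}`"): with our spread condition a
  position `j` is good when `2·j ≤ n`; `card_goodPerm_ge` : `n! ≤ 4^d · #{τ : τ(ι k) good ∀ k}` whenever
  `16 d ≤ n`.

Counting normalisation throughout. No facts, no instances, no notation; standard axioms. WHAT THIS IS NOT:
not a proof of Theorem 1.8/3.1 (that is the assembly brick); nothing about matchings or psd rank; no
P-vs-NP content.
-/

noncomputable section

namespace Literature.Combinatorics.Additive.KeevashLifshitz

open Finset ProductSpace Coupling Tuple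
open scoped InnerProductSpace

variable {n : ℕ}

/-! ## The transfer operator `T_C` -/

/-- **`T_C f`** in the uniform normalisation: `(T_C f)(x) = E_{σ ∼ N(x)} f(σ) = n^n Σ_σ C(σ,x) f(σ)`
(`Σ_σ C(σ,x) = n^{−n}`). [cite: KeevashLifshitz2023, Def. 2.1 ("`T_C f(x) = E_{σ∼N(x)} f(σ)`")] -/
def transfer (f : Equiv.Perm (Fin n) → ℝ) : (Fin n → Fin n) → ℝ :=
  fun x => ((n : ℝ) ^ n) * ∑ σ, coupling σ x * f σ

/-- `n^n > 0` also for `n = 0` (`0^0 = 1`). [folklore] -/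
private theorem pow_self_pos (n : ℕ) : (0 : ℝ) < (n : ℝ) ^ n := by
  rcases Nat.eq_zero_or_pos n with h | h
  · subst h; simp
  · positivity

/-! ## Cylinder sums of the coupling -/

/-- **Integrating out the free coordinates over a cylinder**: for weights `Φ i v`,
`Σ_{x ∈ cyl(S,y)} Π_i Φ i (x i) = Π_{i ∈ S} Φ i (y i) · Π_{i ∉ S} Σ_v Φ i v`.
[cite: KeevashLifshitz2023, Lemma 2.6 (proof: "`b ∼ [n]^{S^c}`")] -/
theorem sum_cylinder_prod (S : Finset (Fin n)) (y : Fin n → Fin n) (Φ : Fin n → Fin n → ℝ) :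
    ∑ x ∈ cylinder S y, ∏ i, Φ i (x i) = (∏ i ∈ S, Φ i (y i)) * ∏ i ∈ Sᶜ, ∑ v, Φ i v := by
  classical
  set Ψ : Fin n → Fin n → ℝ := fun i v => Φ i v * if (i ∈ S → v = y i) then 1 else 0 with hΨ
  have hprod : ∀ x : Fin n → Fin n,
      (if (∀ i ∈ S, x i = y i) then ∏ i, Φ i (x i) else 0) = ∏ i, Ψ i (x i) := by
    intro x
    simp only [hΨ]
    rw [prod_mul_distrib, prod_boole]
    have : (∀ i ∈ (univ : Finset (Fin n)), i ∈ S → x i = y i) ↔ ∀ i ∈ S, x i = y i := by simp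
    simp only [this]
    split_ifs <;> simp
  rw [cylinder, sum_filter]
  simp_rw [hprod]
  rw [← Fintype.piFinset_univ, ← prod_univ_sum, ← prod_mul_prod_compl S]
  congr 1
  · refine prod_congr rfl fun i hi => ?_
    simp only [hΨ]
    rw [show (∑ v, Φ i v * if (i ∈ S → v = y i) then (1 : ℝ) else 0) = ∑ v, if v = y i then Φ i v else 0 from
      sum_congr rfl fun v _ => by
        by_cases hv : v = y i
        · simp [hv]
        · rw [if_neg (fun h => hv (h hi)), if_neg hv, mul_zero]]
    rw [sum_ite_eq']; simp
  · refine prod_congr rfl fun i hi => ?_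
    rw [mem_compl] at hi
    refine sum_congr rfl fun v _ => ?_
    simp only [hΨ]
    rw [if_pos (fun h => (hi h).elim), mul_one]

/-- The number of points of a cylinder: `|cyl(S,y)| = n^{n−|S|}`. [cite: KeevashLifshitz2023, Lemma 2.6] -/
theorem card_cylinder (S : Finset (Fin n)) (y : Fin n → Fin n) :
    ((cylinder S y).card : ℝ) = (n : ℝ) ^ (n - S.card) := by
  have h := sum_cylinder_prod S y (fun _ _ => (1 : ℝ))
  simp only [prod_const_one, sum_const, nsmul_eq_mul, mul_one, card_univ, Fintype.card_fin, one_mul,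
    prod_const] at h
  rw [h, card_compl, Fintype.card_fin]

/-- The **cylinder mass** of the coupling at `σ`: `μ(σ) = Σ_{x ∈ cyl(S,y)} C(σ, x) = (1/n!) Π_{i ∈ S} cw σ i (y i)`
(the free coordinates integrate out). [cite: KeevashLifshitz2023, Lemma 2.6 (proof)] -/
theorem sum_cylinder_coupling (σ : Equiv.Perm (Fin n)) (S : Finset (Fin n)) (y : Fin n → Fin n) :
    ∑ x ∈ cylinder S y, coupling σ x = ((n.factorial : ℝ))⁻¹ * ∏ i ∈ S, cw σ i (y i) := by
  unfold coupling
  rw [← mul_sum, sum_cylinder_prod, prod_eq_one (fun i _ => sum_cw σ i), mul_one]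

/-- **Invariance of the cylinder mass** under renaming values that fix `y|_S`: for `π` with
`π (y i) = y i` (`i ∈ S`), `μ(πσ) = μ(σ)`. [cite: KeevashLifshitz2023, Lemma 2.6 (proof: "by left `S_n`-invariance of the coupling `C`")] -/
theorem sum_cylinder_coupling_lmul {π : Equiv.Perm (Fin n)} {S : Finset (Fin n)} {y : Fin n → Fin n}
    (hπ : ∀ i ∈ S, π (y i) = y i) (σ : Equiv.Perm (Fin n)) :
    ∑ x ∈ cylinder S y, coupling (π * σ) x = ∑ x ∈ cylinder S y, coupling σ x := by
  rw [sum_cylinder_coupling, sum_cylinder_coupling]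
  congr 1
  refine prod_congr rfl fun i hi => ?_
  conv_lhs => rw [← hπ i hi]
  exact cw_lmul π σ i (y i)

/-- `Σ_σ μ(σ) = |cyl| / n^n`. [cite: KeevashLifshitz2023, Lemma 2.6] -/
theorem sum_sum_cylinder_coupling (S : Finset (Fin n)) (y : Fin n → Fin n) :
    ∑ σ : Equiv.Perm (Fin n), ∑ x ∈ cylinder S y, coupling σ x = (n : ℝ) ^ (n - S.card) / (n : ℝ) ^ n := by
  rw [sum_comm, sum_congr rfl (fun x _ => sum_coupling_left x), sum_const, nsmul_eq_mul, card_cylinder,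
    div_eq_mul_inv]

/-! ## The pointwise stabiliser of the values `y(S)` and its orbits -/

/-- The permutations fixing every value `y i`, `i ∈ S`. [cite: KeevashLifshitz2023, Lemma 2.6 (the group `U`)] -/
def stabVal (S : Finset (Fin n)) (y : Fin n → Fin n) : Finset (Equiv.Perm (Fin n)) :=
  univ.filter fun π => ∀ i ∈ S, π (y i) = y i

/-- [cite: KeevashLifshitz2023, Lemma 2.6] -/
theorem mem_stabVal {S : Finset (Fin n)} {y : Fin n → Fin n} {π : Equiv.Perm (Fin n)} :
    π ∈ stabVal S y ↔ ∀ i ∈ S, π (y i) = y i := by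
  simp [stabVal]

/-- **Averaging over the stabiliser**: if `μ(πσ) = μ(σ)` for `π ∈ G = stabVal S y` then
`|G| · Σ_σ Φ(σ) μ(σ) = Σ_σ μ(σ) Σ_{π ∈ G} Φ(πσ)`. [cite: KeevashLifshitz2023, Lemma 2.6 (proof)] -/
theorem card_mul_sum_eq_sum_orbit (S : Finset (Fin n)) (y : Fin n → Fin n)
    (μ Φ : Equiv.Perm (Fin n) → ℝ) (hμ : ∀ π ∈ stabVal S y, ∀ σ, μ (π * σ) = μ σ) :
    ((stabVal S y).card : ℝ) * ∑ σ, Φ σ * μ σ = ∑ σ, μ σ * ∑ π ∈ stabVal S y, Φ (π * σ) := by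
  classical
  have h1 : ((stabVal S y).card : ℝ) * ∑ σ, Φ σ * μ σ =
      ∑ π ∈ stabVal S y, ∑ σ, Φ (π * σ) * μ (π * σ) := by
    rw [sum_congr rfl (fun π _ => Fintype.sum_equiv (Equiv.mulLeft π)
      (fun σ => Φ (π * σ) * μ (π * σ)) (fun σ => Φ σ * μ σ) (fun σ => rfl)), sum_const, nsmul_eq_mul]
  rw [h1, sum_comm]
  refine sum_congr rfl fun σ _ => ?_
  rw [mul_sum]
  exact sum_congr rfl fun π hπ => by rw [hμ π hπ σ, mul_comm]

/-- The distinct values of `y` on `S`, enumerated increasingly: an injective `J : Fin t' → Fin n` with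
`t' = |y(S)|`. [cite: KeevashLifshitz2023, Lemma 2.6 (proof: the umvirate `∩_{i∈S} U_{σ⁻¹(a_i) → a_i}`)] -/
def valEnum (S : Finset (Fin n)) (y : Fin n → Fin n) : Fin (S.image y).card → Fin n :=
  fun k => ((S.image y).orderIsoOfFin rfl k : Fin n)

/-- [cite: KeevashLifshitz2023, Lemma 2.6] -/
theorem valEnum_mem (S : Finset (Fin n)) (y : Fin n → Fin n) (k : Fin (S.image y).card) :
    valEnum S y k ∈ S.image y :=
  ((S.image y).orderIsoOfFin rfl k).2

/-- [cite: KeevashLifshitz2023, Lemma 2.6] -/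
theorem valEnum_injective (S : Finset (Fin n)) (y : Fin n → Fin n) : Function.Injective (valEnum S y) := by
  intro k l h
  simp only [valEnum] at h
  exact ((S.image y).orderIsoOfFin rfl).injective (Subtype.ext h)

/-- [cite: KeevashLifshitz2023, Lemma 2.6] -/
theorem exists_valEnum_eq {S : Finset (Fin n)} {y : Fin n → Fin n} {v : Fin n} (hv : v ∈ S.image y) :
    ∃ k, valEnum S y k = v :=
  ⟨((S.image y).orderIsoOfFin rfl).symm ⟨v, hv⟩, by simp [valEnum]⟩

/-- **The orbit of `σ` under the stabiliser is an umvirate**: `Σ_{π ∈ G} Φ(πσ) = Σ_{σ' ∈ U_{I→J}} Φ σ'`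
with `J` the distinct values of `y|_S` and `I = σ⁻¹ ∘ J`.
[cite: KeevashLifshitz2023, Lemma 2.6 (proof: "`σ` is uniform in `∩_{i ∈ S} U_{σ⁻¹(a_i) → a_i}`")] -/
theorem sum_stabVal_eq_sum_umvirate (S : Finset (Fin n)) (y : Fin n → Fin n) (Φ : Equiv.Perm (Fin n) → ℝ)
    (σ : Equiv.Perm (Fin n)) :
    ∑ π ∈ stabVal S y, Φ (π * σ) =
      ∑ σ' ∈ umvirate (fun k => σ.symm (valEnum S y k)) (valEnum S y), Φ σ' := by
  classical
  refine sum_nbij' (fun π => π * σ) (fun σ' => σ' * σ⁻¹) ?_ ?_ (fun π _ => by simp) (fun σ' _ => by simp)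
    (fun _ _ => rfl)
  · intro π hπ
    rw [mem_stabVal] at hπ
    rw [mem_umvirate]
    intro k
    obtain ⟨i, hi, hik⟩ := mem_image.1 (valEnum_mem S y k)
    rw [Equiv.Perm.mul_apply, Equiv.apply_symm_apply, ← hik, hπ i hi]
  · intro σ' hσ'
    rw [mem_umvirate] at hσ'
    rw [mem_stabVal]
    intro i hi
    obtain ⟨k, hk⟩ := exists_valEnum_eq (mem_image_of_mem y hi)
    rw [← hk, Equiv.Perm.mul_apply]
    have := hσ' k
    rw [show σ⁻¹ (valEnum S y k) = σ.symm (valEnum S y k) from rfl, this]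

/-- [cite: KeevashLifshitz2023, Lemma 2.6] -/
theorem card_stabVal_eq (S : Finset (Fin n)) (y : Fin n → Fin n) (σ : Equiv.Perm (Fin n)) :
    ((stabVal S y).card : ℝ) = (umvirate (fun k => σ.symm (valEnum S y k)) (valEnum S y)).card := by
  have h := sum_stabVal_eq_sum_umvirate S y (fun _ => (1 : ℝ)) σ
  simpa using h

/-- The stabiliser is nonempty (contains `1`). [cite: KeevashLifshitz2023, Lemma 2.6] -/
theorem card_stabVal_pos (S : Finset (Fin n)) (y : Fin n → Fin n) : 0 < (stabVal S y).card :=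
  card_pos.2 ⟨1, mem_stabVal.2 fun _ _ => rfl⟩

/-! ## Lemma 2.7: biglobalness is preserved -/

/-- **The key averaging bound**: for `Φ ≥ 0` with `Σ_{σ' ∈ U} Φ σ' ≤ B·|U|` on every umvirate `U` of the
orbit type of `(S, y)`, `Σ_σ Φ(σ) μ(σ) ≤ B Σ_σ μ(σ)` (`μ` the cylinder mass).
[cite: KeevashLifshitz2023, Lemma 2.6 (proof)] -/
theorem sum_mul_cylMass_le (S : Finset (Fin n)) (y : Fin n → Fin n) (Φ : Equiv.Perm (Fin n) → ℝ) (B : ℝ)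
    (hB : ∀ σ : Equiv.Perm (Fin n),
      (∑ σ' ∈ umvirate (fun k => σ.symm (valEnum S y k)) (valEnum S y), Φ σ') ≤
        B * ((umvirate (fun k => σ.symm (valEnum S y k)) (valEnum S y)).card : ℝ)) :
    ∑ σ, Φ σ * ∑ x ∈ cylinder S y, coupling σ x ≤ B * ∑ σ, ∑ x ∈ cylinder S y, coupling σ x := by
  classical
  set μ : Equiv.Perm (Fin n) → ℝ := fun σ => ∑ x ∈ cylinder S y, coupling σ x with hμdef
  have hG : (0 : ℝ) < ((stabVal S y).card : ℝ) := by exact_mod_cast card_stabVal_pos S y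
  have hμ0 : ∀ σ, 0 ≤ μ σ := fun σ => sum_nonneg fun x _ => coupling_nonneg σ x
  have havg := card_mul_sum_eq_sum_orbit S y μ Φ (fun π hπ σ => sum_cylinder_coupling_lmul (mem_stabVal.1 hπ) σ)
  -- bound each orbit sum
  have hbound : ∑ σ, μ σ * ∑ π ∈ stabVal S y, Φ (π * σ) ≤ ∑ σ, μ σ * (B * ((stabVal S y).card : ℝ)) := by
    refine sum_le_sum fun σ _ => mul_le_mul_of_nonneg_left ?_ (hμ0 σ)
    rw [sum_stabVal_eq_sum_umvirate, card_stabVal_eq S y σ]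
    exact hB σ
  rw [← havg, ← sum_mul, mul_comm B, ← mul_assoc] at hbound
  have : ((stabVal S y).card : ℝ) * ∑ σ, Φ σ * μ σ ≤ ((stabVal S y).card : ℝ) * (B * ∑ σ, μ σ) := by
    calc _ ≤ (∑ σ, μ σ) * ((stabVal S y).card : ℝ) * B := hbound
      _ = _ := by ring
  exact le_of_mul_le_mul_left this hG

/-- Weighted Cauchy–Schwarz: `(Σ c f)² ≤ (Σ c)(Σ c f²)` for `c ≥ 0`. [folklore] -/
private theorem sq_sum_mul_le {ι : Type*} (s : Finset ι) (c f : ι → ℝ) (hc : ∀ i ∈ s, 0 ≤ c i) :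
    (∑ i ∈ s, c i * f i) ^ 2 ≤ (∑ i ∈ s, c i) * ∑ i ∈ s, c i * f i ^ 2 := by
  have h := sum_mul_sq_le_sq_mul_sq s (fun i => Real.sqrt (c i)) (fun i => Real.sqrt (c i) * f i)
  have e1 : ∀ i ∈ s, Real.sqrt (c i) * (Real.sqrt (c i) * f i) = c i * f i := fun i hi => by
    rw [← mul_assoc, Real.mul_self_sqrt (hc i hi)]
  have e2 : ∀ i ∈ s, Real.sqrt (c i) ^ 2 = c i := fun i hi => Real.sq_sqrt (hc i hi)
  have e3 : ∀ i ∈ s, (Real.sqrt (c i) * f i) ^ 2 = c i * f i ^ 2 := fun i hi => by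
    rw [mul_pow, Real.sq_sqrt (hc i hi)]
  rwa [sum_congr rfl e1, sum_congr rfl e2, sum_congr rfl e3] at h

/-- **KL Lemma 2.7** (biglobalness is preserved by the coupling): if `f` is `(r, γ₁, γ₂, d)`-biglobal on
`S_n` (`r ≥ 1`, `γ₁ ≥ 0`) then `T_C f` is `(r, γ₁, γ₂, d)`-biglobal on `[n]^n`.
[cite: KeevashLifshitz2023, Lemma 2.7 (and Lemma 2.6 for the proof)] -/
theorem isBiglobalX_transfer {f : Equiv.Perm (Fin n) → ℝ} {r γ₁ γ₂ : ℝ} {d : ℕ} (hr : 1 ≤ r) (hγ₁ : 0 ≤ γ₁)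
    (hf : IsBiglobal r γ₁ γ₂ d f) : IsBiglobalX r γ₁ γ₂ d (transfer f) := by
  classical
  intro S hS y
  have hnn := pow_self_pos n
  -- the orbit type of `(S, y)`: `t' = |y(S)| ≤ |S| ≤ d` distinct values
  set t' := (S.image y).card with ht'
  have ht'S : t' ≤ S.card := card_image_le
  have hrt : r ^ t' ≤ r ^ S.card := pow_le_pow_right₀ hr ht'S
  have hI : ∀ σ : Equiv.Perm (Fin n), Function.Injective (fun k => σ.symm (valEnum S y k)) :=
    fun σ k l h => valEnum_injective S y (σ.symm.injective h)
  have hmass := sum_sum_cylinder_coupling S y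
  constructor
  · -- L¹
    have hB := sum_mul_cylMass_le S y (fun σ => |f σ|) (r ^ S.card * γ₁) (fun σ => by
      have h1 := (hf t' (ht'S.trans hS) _ _ (hI σ) (valEnum_injective S y)).1
      exact h1.trans (mul_le_mul_of_nonneg_right (mul_le_mul_of_nonneg_right hrt hγ₁) (by positivity)))
    calc ∑ x ∈ cylinder S y, |transfer f x|
        ≤ ∑ x ∈ cylinder S y, (n : ℝ) ^ n * ∑ σ, coupling σ x * |f σ| := by
          refine sum_le_sum fun x _ => ?_
          rw [transfer, abs_mul, abs_of_pos hnn]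
          refine mul_le_mul_of_nonneg_left ((abs_sum_le_sum_abs _ _).trans (le_of_eq ?_)) hnn.le
          exact sum_congr rfl fun σ _ => by rw [abs_mul, abs_of_nonneg (coupling_nonneg σ x)]
      _ = (n : ℝ) ^ n * ∑ σ, |f σ| * ∑ x ∈ cylinder S y, coupling σ x := by
          rw [← mul_sum, sum_comm]
          congr 1
          exact sum_congr rfl fun σ _ => by rw [mul_sum]; exact sum_congr rfl fun x _ => mul_comm _ _
      _ ≤ (n : ℝ) ^ n * (r ^ S.card * γ₁ * ∑ σ, ∑ x ∈ cylinder S y, coupling σ x) :=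
          mul_le_mul_of_nonneg_left hB hnn.le
      _ = r ^ S.card * γ₁ * (n : ℝ) ^ (n - S.card) := by
          rw [hmass]; field_simp
  · -- L²
    have hB := sum_mul_cylMass_le S y (fun σ => f σ ^ 2) ((r ^ S.card * γ₂) ^ 2) (fun σ => by
      have h2 := (hf t' (ht'S.trans hS) _ _ (hI σ) (valEnum_injective S y)).2
      refine h2.trans (mul_le_mul_of_nonneg_right ?_ (by positivity))
      rw [mul_pow, mul_pow, ← pow_mul, ← pow_mul]
      exact mul_le_mul_of_nonneg_right (pow_le_pow_right₀ hr (by omega)) (sq_nonneg _))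
    calc ∑ x ∈ cylinder S y, transfer f x ^ 2
        ≤ ∑ x ∈ cylinder S y, (n : ℝ) ^ n * ∑ σ, coupling σ x * f σ ^ 2 := by
          refine sum_le_sum fun x _ => ?_
          rw [transfer, mul_pow]
          have hcs := sq_sum_mul_le univ (fun σ => coupling σ x) f (fun σ _ => coupling_nonneg σ x)
          rw [sum_coupling_left x] at hcs
          calc ((n : ℝ) ^ n) ^ 2 * (∑ σ, coupling σ x * f σ) ^ 2
              ≤ ((n : ℝ) ^ n) ^ 2 * (((n : ℝ) ^ n)⁻¹ * ∑ σ, coupling σ x * f σ ^ 2) :=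
                mul_le_mul_of_nonneg_left hcs (by positivity)
            _ = (n : ℝ) ^ n * ∑ σ, coupling σ x * f σ ^ 2 := by field_simp
      _ = (n : ℝ) ^ n * ∑ σ, f σ ^ 2 * ∑ x ∈ cylinder S y, coupling σ x := by
          rw [← mul_sum, sum_comm]
          congr 1
          exact sum_congr rfl fun σ _ => by rw [mul_sum]; exact sum_congr rfl fun x _ => mul_comm _ _
      _ ≤ (n : ℝ) ^ n * ((r ^ S.card * γ₂) ^ 2 * ∑ σ, ∑ x ∈ cylinder S y, coupling σ x) :=
          mul_le_mul_of_nonneg_left hB hnn.le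
      _ = (r ^ S.card * γ₂) ^ 2 * (n : ℝ) ^ (n - S.card) := by
          rw [hmass]; field_simp

/-! ## Right translates -/

/-- Right translation `(R_τ f)(σ) = f(στ)`. [cite: KeevashLifshitz2023, §1.1 ("`f^σ(x) = f(xσ)`")] -/
def rshift (τ : Equiv.Perm (Fin n)) (f : Equiv.Perm (Fin n) → ℝ) : Equiv.Perm (Fin n) → ℝ :=
  fun σ => f (σ * τ)

/-- A right translate of an umvirate is an umvirate: `{σ : στ ∈ U_{I→J}} = U_{τ∘I → J}`, in the form
`Σ_{σ ∈ U_{τ∘I→J}} Φ(στ) = Σ_{σ ∈ U_{I→J}} Φ(σ)`.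
[cite: KeevashLifshitz2023, Lemma 3.6 (proof: "clearly `R_σ f` has the same biglobalness as `f`")] -/
theorem sum_umvirate_rshift {t : ℕ} (τ : Equiv.Perm (Fin n)) (I J : Fin t → Fin n) (Φ : Equiv.Perm (Fin n) → ℝ) :
    ∑ σ ∈ umvirate (fun k => τ (I k)) J, Φ (σ * τ) = ∑ σ ∈ umvirate I J, Φ σ := by
  classical
  refine sum_nbij' (fun σ => σ * τ) (fun σ => σ * τ⁻¹) ?_ ?_ (fun σ _ => by simp) (fun σ _ => by simp)
    (fun _ _ => rfl)
  · intro σ hσ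
    rw [mem_umvirate] at hσ ⊢
    intro k; rw [Equiv.Perm.mul_apply]; exact hσ k
  · intro σ hσ
    rw [mem_umvirate] at hσ ⊢
    intro k
    rw [Equiv.Perm.mul_apply]
    show σ (τ.symm (τ (I k))) = J k
    rw [Equiv.symm_apply_apply]
    exact hσ k

/-- [cite: KeevashLifshitz2023, Lemma 3.6 (proof)] -/
theorem card_umvirate_rshift {t : ℕ} (τ : Equiv.Perm (Fin n)) (I J : Fin t → Fin n) :
    ((umvirate (fun k => τ (I k)) J).card : ℝ) = (umvirate I J).card := by
  have h := sum_umvirate_rshift τ I J (fun _ => (1 : ℝ))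
  simpa using h

/-- **Right translates keep biglobalness.** [cite: KeevashLifshitz2023, Lemma 3.6 (proof)] -/
theorem isBiglobal_rshift {f : Equiv.Perm (Fin n) → ℝ} {r γ₁ γ₂ : ℝ} {d : ℕ} (hf : IsBiglobal r γ₁ γ₂ d f)
    (τ : Equiv.Perm (Fin n)) : IsBiglobal r γ₁ γ₂ d (rshift τ f) := by
  intro t ht I J hI hJ
  -- `U_{I→J} = U_{τ∘I'→J}` with `I' = τ⁻¹∘I`, and `{στ : σ ∈ U_{τ∘I'→J}} = U_{I'→J}`
  set I' : Fin t → Fin n := fun k => τ.symm (I k) with hI'def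
  have hI' : Function.Injective I' := fun k l h => hI (τ.symm.injective h)
  have hII : I = fun k => τ (I' k) := funext fun k => (Equiv.apply_symm_apply τ (I k)).symm
  obtain ⟨h1, h2⟩ := hf t ht I' J hI' hJ
  have e1 : ∑ σ ∈ umvirate I J, |rshift τ f σ| = ∑ σ ∈ umvirate I' J, |f σ| := by
    rw [hII]; exact sum_umvirate_rshift τ I' J (fun σ => |f σ|)
  have e2 : ∑ σ ∈ umvirate I J, rshift τ f σ ^ 2 = ∑ σ ∈ umvirate I' J, f σ ^ 2 := by
    rw [hII]; exact sum_umvirate_rshift τ I' J (fun σ => f σ ^ 2)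
  have e3 : ((umvirate I J).card : ℝ) = (umvirate I' J).card := by
    rw [hII]; exact card_umvirate_rshift τ I' J
  rw [e1, e2, e3]
  exact ⟨h1, h2⟩

/-! ## Juntas of pure degree `d` -/

variable {d : ℕ}

/-- `F` is an **`ι`-junta**: it depends only on the values at the positions `ι`.
[cite: KeevashLifshitz2023, §1.2 ("`f` is an `I`-junta if `f(σ)` only depends on `(σ(i) : i ∈ I)`")] -/
def IsJunta (ι : Fin d ↪ Fin n) (F : Equiv.Perm (Fin n) → ℝ) : Prop :=
  ∀ σ σ' : Equiv.Perm (Fin n), restrictPerm ι σ = restrictPerm ι σ' → F σ = F σ'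

/-- The function `g` on `[n]_d` underlying an `ι`-junta: `g(a) = F(σ)` for any `σ` with `σ∘ι = a`.
[cite: KeevashLifshitz2023, §2.4 ("`g ∈ L²([n]_d)` naturally defined by `g(J) = f(σ)` for any/all `σ ∈ U_{I→J}`")] -/
def juntaFun (ι : Fin d ↪ Fin n) (F : Equiv.Perm (Fin n) → ℝ) : (Fin d ↪ Fin n) → ℝ :=
  fun a => F (Classical.choose (Tuple.exists_perm_lmap_eq ι a))

/-- [cite: KeevashLifshitz2023, §2.4] -/
theorem restrictPerm_choose (ι a : Fin d ↪ Fin n) :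
    restrictPerm ι (Classical.choose (Tuple.exists_perm_lmap_eq ι a)) = a :=
  Classical.choose_spec (Tuple.exists_perm_lmap_eq ι a)

/-- An `ι`-junta is the lift of its underlying function. [cite: KeevashLifshitz2023, §2.4] -/
theorem liftFun_juntaFun {ι : Fin d ↪ Fin n} {F : Equiv.Perm (Fin n) → ℝ} (hF : IsJunta ι F) :
    liftFun ι (juntaFun ι F) = F := by
  funext σ
  unfold liftFun juntaFun
  exact hF _ _ (restrictPerm_choose ι (restrictPerm ι σ))

/-- A line of `[n]_d` at coordinate `i` lifts to the `(d−1)`-umvirate pinning the other coordinates.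
[cite: KeevashLifshitz2023, Lemma 2.16 (proof: the adjoint `F*` of restriction)] -/
theorem sum_umvirate_succAbove_eq {d' : ℕ} (ι : Fin (d' + 1) ↪ Fin n) (g : (Fin (d' + 1) ↪ Fin n) → ℝ)
    (i : Fin (d' + 1)) (a : Fin (d' + 1) ↪ Fin n) :
    ∑ σ ∈ umvirate (fun k => ι (i.succAbove k)) (fun k => a (i.succAbove k)), liftFun ι g σ =
      (((univ : Finset (Equiv.Perm (Fin n))).filter (fun σ => restrictPerm ι σ = a)).card : ℝ) *
        ∑ b ∈ line i a, g b := by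
  classical
  -- the umvirate is the union of the fibres over the line
  have hmem : ∀ σ : Equiv.Perm (Fin n),
      σ ∈ umvirate (fun k => ι (i.succAbove k)) (fun k => a (i.succAbove k)) ↔ restrictPerm ι σ ∈ line i a := by
    intro σ
    rw [mem_umvirate, mem_line]
    constructor
    · intro h j hj
      obtain ⟨k, rfl⟩ := Fin.exists_succAbove_eq hj
      exact h k
    · intro h k
      exact h _ (Fin.succAbove_ne i k)
  rw [show umvirate (fun k => ι (i.succAbove k)) (fun k => a (i.succAbove k)) =
      (univ : Finset (Equiv.Perm (Fin n))).filter (fun σ => restrictPerm ι σ ∈ line i a) by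
    ext σ; rw [hmem, mem_filter]; simp]
  rw [← sum_fiberwise_of_maps_to (s := univ.filter (fun σ => restrictPerm ι σ ∈ line i a)) (t := line i a)
    (g := fun σ => restrictPerm ι σ) (fun σ hσ => (mem_filter.1 hσ).2)]
  rw [mul_sum]
  refine sum_congr rfl fun b hb => ?_
  have hfib : (univ.filter (fun σ => restrictPerm ι σ ∈ line i a)).filter (fun σ => restrictPerm ι σ = b) =
      univ.filter (fun σ => restrictPerm ι σ = b) := by
    ext σ
    simp only [mem_filter, mem_univ, true_and]
    constructor
    · exact fun h => h.2
    · intro h; exact ⟨by rw [h]; exact hb, h⟩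
  have hcongr : ∀ σ ∈ (univ : Finset (Equiv.Perm (Fin n))).filter (fun σ => restrictPerm ι σ = b),
      liftFun ι g σ = g b := by
    intro σ hσ
    rw [mem_filter] at hσ
    show g (restrictPerm ι σ) = g b
    rw [hσ.2]
  rw [hfib, sum_congr rfl hcongr, sum_const, nsmul_eq_mul]
  -- all fibres have the same size
  have h1 := card_fibre_mul_card ι b
  have h2 := card_fibre_mul_card ι a
  have hN : (0 : ℝ) < (Fintype.card (Fin (d' + 1) ↪ Fin n) : ℝ) := by exact_mod_cast Fintype.card_pos_iff.2 ⟨a⟩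
  rw [mul_right_cancel₀ hN.ne' (h1.trans h2.symm)]

/-- **Pure degree `d` juntas have pure-top underlying functions**: if the `ι`-junta `F` sums to zero on
every umvirate with `≤ d − 1` pinned positions (i.e. `F ⊥ V_{≤ d−1}`), then `juntaFun ι F` has all line
sums zero. [cite: KeevashLifshitz2023, §2.4 ("we may assume `f ∈ V_{=d}`, and so `g ∈ V_{=d}(L²([n]_d))`")] -/
theorem isPureTop_juntaFun {ι : Fin d ↪ Fin n} {F : Equiv.Perm (Fin n) → ℝ} (hF : IsJunta ι F)
    (horth : ∀ t : ℕ, t + 1 ≤ d → ∀ I J : Fin t → Fin n, ∑ σ ∈ umvirate I J, F σ = 0) :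
    IsPureTop (juntaFun ι F) := by
  classical
  intro i a
  obtain ⟨d', rfl⟩ : ∃ d', d = d' + 1 := Nat.exists_eq_succ_of_ne_zero (Nat.pos_iff_ne_zero.1 (Fin.pos i))
  have h := sum_umvirate_succAbove_eq ι (juntaFun ι F) i a
  rw [liftFun_juntaFun hF, horth d' le_rfl] at h
  have hM : (0 : ℝ) < (((univ : Finset (Equiv.Perm (Fin n))).filter (fun σ => restrictPerm ι σ = a)).card : ℝ) := by
    have : Classical.choose (Tuple.exists_perm_lmap_eq ι a) ∈
        (univ : Finset (Equiv.Perm (Fin n))).filter (fun σ => restrictPerm ι σ = a) := by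
      rw [mem_filter]; exact ⟨mem_univ _, restrictPerm_choose ι a⟩
    exact_mod_cast card_pos.2 ⟨_, this⟩
  rcases mul_eq_zero.1 h.symm with h0 | h0
  · exact absurd h0 hM.ne'
  · exact h0

/-- The associated `[n]^n`-junta lies in `V_{≤d}` of the product space.
[cite: KeevashLifshitz2023, §2.3 ("The degree of `R_τ f̃` is at most `d`")] -/
theorem vecX_liftFunX_mem_degLEX (ι : Fin d ↪ Fin n) (g : (Fin d ↪ Fin n) → ℝ) :
    vecX (liftFunX ι g) ∈ degLEX n n d := by
  classical
  refine vecX_mem_degLEX_of_junta (S := univ.map ι) (by rw [card_map, card_univ, Fintype.card_fin]) _ ?_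
  intro x x' h
  have : (fun k => x (ι k)) = fun k => x' (ι k) := funext fun k => h (ι k) (mem_map_of_mem ι (mem_univ k))
  unfold liftFunX
  rw [this]

/-- Summing over functions by their injective part: `Σ_b [b injective] G(b)² = Σ_{e : Fin d ↪ Fin n} G(e)²`. [folklore] -/
private theorem sum_dite_injective_sq (G : (Fin d ↪ Fin n) → ℝ) :
    ∑ b : Fin d → Fin n, (if h : Function.Injective b then G ⟨b, h⟩ else 0) ^ 2 =
      ∑ e : Fin d ↪ Fin n, G e ^ 2 := by
  classical
  symm
  rw [show (∑ e : Fin d ↪ Fin n, G e ^ 2) =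
      ∑ e : Fin d ↪ Fin n, (fun b : Fin d → Fin n =>
        (if h : Function.Injective b then G ⟨b, h⟩ else 0) ^ 2) (⇑e) from
    sum_congr rfl fun e _ => by
      show G e ^ 2 = (if h : Function.Injective (⇑e) then G ⟨⇑e, h⟩ else 0) ^ 2
      rw [dif_pos e.injective]
      congr 2]
  rw [← sum_image (f := fun b : Fin d → Fin n => (if h : Function.Injective b then G ⟨b, h⟩ else 0) ^ 2)
    (s := (univ : Finset (Fin d ↪ Fin n))) (g := fun e => (⇑e : Fin d → Fin n))
    (fun e₁ _ e₂ _ h => DFunLike.coe_injective h)]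
  refine sum_subset (subset_univ _) fun b _ hb => ?_
  have : ¬ Function.Injective b := fun h => hb (mem_image.2 ⟨⟨b, h⟩, mem_univ _, rfl⟩)
  simp [this]

/-- The number of points of `[n]^n` with prescribed values at the positions `ι` is `n^{n−d}`.
[cite: KeevashLifshitz2023, §2.4 ("`P(E) = |[n]_d|/n^d`")] -/
theorem sum_ite_restrict_eq (ι : Fin d ↪ Fin n) (b : Fin d → Fin n) :
    ∑ x : Fin n → Fin n, (if (fun k => x (ι k)) = b then (1 : ℝ) else 0) = (n : ℝ) ^ (n - d) := by
  classical
  have h := sum_constrained_prod ι b (fun _ _ => (1 : ℝ))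
  simp only [prod_const_one, sum_const, card_univ, Fintype.card_fin, nsmul_eq_mul, mul_one, one_mul,
    prod_const, card_compl, card_map] at h
  rw [← h]
  refine sum_congr rfl fun x _ => ?_
  congr 1
  exact propext ⟨fun e k => congr_fun e k, fun e => funext e⟩

/-- `‖f̃‖² = n^{n−d} Σ_b g(b)²` for the associated `[n]^n`-junta. [cite: KeevashLifshitz2023, §2.3 ("`‖f̃‖ ≤ ‖f‖`")] -/
theorem sum_liftFunX_sq (ι : Fin d ↪ Fin n) (g : (Fin d ↪ Fin n) → ℝ) :
    ∑ x : Fin n → Fin n, liftFunX ι g x ^ 2 = (n : ℝ) ^ (n - d) * ∑ e : Fin d ↪ Fin n, g e ^ 2 := by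
  classical
  -- group `x` by `b = x ∘ ι`
  rw [← sum_fiberwise (s := (univ : Finset (Fin n → Fin n))) (g := fun x => fun k => x (ι k))
    (f := fun x => liftFunX ι g x ^ 2)]
  rw [← sum_dite_injective_sq, mul_sum]
  refine sum_congr rfl fun b _ => ?_
  have hval : ∀ x : Fin n → Fin n, (fun k => x (ι k)) = b →
      liftFunX ι g x ^ 2 = (if h : Function.Injective b then g ⟨b, h⟩ else 0) ^ 2 := by
    intro x hxb; unfold liftFunX; subst hxb; rfl
  have hcongr : ∀ x ∈ (univ : Finset (Fin n → Fin n)).filter (fun x => (fun k => x (ι k)) = b),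
      liftFunX ι g x ^ 2 = (if h : Function.Injective b then g ⟨b, h⟩ else 0) ^ 2 :=
    fun x hx => hval x (mem_filter.1 hx).2
  rw [sum_congr rfl hcongr, sum_const, nsmul_eq_mul]
  congr 1
  rw [← sum_ite_restrict_eq ι b, sum_boole]

/-- **`‖f̃‖² · n! ≤ n^n · ‖f‖²`** (counting norms; the paper's `‖f̃‖₂ ≤ ‖f‖₂` in expectation norms), for
`f = liftFun ι g` and `d ≤ n`. [cite: KeevashLifshitz2023, §2.3 ("by orthogonality, Cauchy–Schwartz and `‖f̃‖ ≤ ‖f‖`")] -/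
theorem norm_liftFunX_sq_le (ι : Fin d ↪ Fin n) (g : (Fin d ↪ Fin n) → ℝ) (hdn : d ≤ n) :
    (∑ x : Fin n → Fin n, liftFunX ι g x ^ 2) * n.factorial ≤
      (n : ℝ) ^ n * ∑ σ : Equiv.Perm (Fin n), liftFun ι g σ ^ 2 := by
  classical
  rw [sum_liftFunX_sq, sum_liftFun_sq ι g ι]
  set M : ℝ := (((univ : Finset (Equiv.Perm (Fin n))).filter (fun σ => restrictPerm ι σ = ι)).card : ℝ)
  set G : ℝ := ∑ e : Fin d ↪ Fin n, g e ^ 2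
  have hMN : M * (Fintype.card (Fin d ↪ Fin n) : ℝ) = n.factorial := card_fibre_mul_card ι ι
  have hN : (Fintype.card (Fin d ↪ Fin n) : ℝ) ≤ (n : ℝ) ^ d := by
    rw [Fintype.card_embedding_eq, Fintype.card_fin, Fintype.card_fin]
    exact_mod_cast Nat.descFactorial_le_pow n d
  have hG : 0 ≤ G := sum_nonneg fun _ _ => sq_nonneg _
  have hM0 : 0 ≤ M := by positivity
  calc (n : ℝ) ^ (n - d) * G * n.factorial = (n : ℝ) ^ (n - d) * G * (M * Fintype.card (Fin d ↪ Fin n)) := by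
        rw [hMN]
    _ ≤ (n : ℝ) ^ (n - d) * G * (M * (n : ℝ) ^ d) := by gcongr
    _ = (n : ℝ) ^ (n - d + d) * (M * G) := by rw [pow_add]; ring
    _ = (n : ℝ) ^ n * (M * G) := by rw [Nat.sub_add_cancel hdn]

/-! ## Counting the good translates -/

/-- The good positions: `j` with `2j ≤ n` (lazy weight `≥ 1/2`). [cite: KeevashLifshitz2023, §2.3 ("`T ⊂ [n/4, n/2]`")] -/
def goodPos (n : ℕ) : Finset (Fin n) := univ.filter fun j : Fin n => 2 * (j : ℕ) ≤ n

/-- At least `n/2 + 1` positions are good. [cite: KeevashLifshitz2023, §2.3] -/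
theorem card_goodPos_ge (hn : 0 < n) : n / 2 + 1 ≤ (goodPos n).card := by
  classical
  have hlt : ∀ j : ℕ, j < n / 2 + 1 → j < n := fun j hj => by omega
  let e : Fin (n / 2 + 1) → Fin n := fun j => ⟨j, hlt j j.2⟩
  have hinj : Function.Injective e := fun j k h => by
    have := congr_arg Fin.val h; exact Fin.ext this
  have hsub : univ.image e ⊆ goodPos n := by
    intro x hx
    obtain ⟨j, -, rfl⟩ := mem_image.1 hx
    rw [goodPos, mem_filter]
    refine ⟨mem_univ _, ?_⟩
    show 2 * (j : ℕ) ≤ n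
    have := j.2; omega
  calc n / 2 + 1 = (univ.image e).card := by rw [card_image_of_injective _ hinj, card_univ, Fintype.card_fin]
    _ ≤ (goodPos n).card := card_le_card hsub

/-- The translates mapping the positions `ι` into good positions. [cite: KeevashLifshitz2023, §2.3] -/
def goodPerm (ι : Fin d ↪ Fin n) : Finset (Equiv.Perm (Fin n)) :=
  univ.filter fun τ => ∀ k, 2 * ((τ (ι k) : Fin n) : ℕ) ≤ n

/-- [cite: KeevashLifshitz2023, §2.3] -/
theorem mem_goodPerm {ι : Fin d ↪ Fin n} {τ : Equiv.Perm (Fin n)} :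
    τ ∈ goodPerm ι ↔ ∀ k, 2 * ((τ (ι k) : Fin n) : ℕ) ≤ n := by
  simp [goodPerm]

/-- `#goodPerm ι · |[n]_d| = (number of good `d`-tuples) · n!`: the fibres of `τ ↦ τ∘ι` all have size
`n!/|[n]_d|`. [cite: KeevashLifshitz2023, §2.3 ("`P_τ(τ(T) ⊂ …)`")] -/
theorem card_goodPerm_mul (ι : Fin d ↪ Fin n) :
    ((goodPerm ι).card : ℝ) * (Fintype.card (Fin d ↪ Fin n) : ℝ) =
      (((univ : Finset (Fin d ↪ Fin n)).filter (fun a => ∀ k, 2 * ((a k : Fin n) : ℕ) ≤ n)).card : ℝ) *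
        n.factorial := by
  classical
  -- fibrewise over `a = τ ∘ ι`
  have hfib := card_eq_sum_card_fiberwise (s := goodPerm ι)
    (t := (univ : Finset (Fin d ↪ Fin n)).filter (fun a => ∀ k, 2 * ((a k : Fin n) : ℕ) ≤ n))
    (f := fun τ => restrictPerm ι τ) (fun τ hτ => by
      rw [mem_coe, mem_goodPerm] at hτ
      exact mem_coe.2 (mem_filter.2 ⟨mem_univ _, fun k => hτ k⟩))
  have hconst : ∀ a ∈ (univ : Finset (Fin d ↪ Fin n)).filter (fun a => ∀ k, 2 * ((a k : Fin n) : ℕ) ≤ n),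
      ((goodPerm ι).filter (fun τ => restrictPerm ι τ = a)).card =
      ((univ : Finset (Equiv.Perm (Fin n))).filter (fun τ => restrictPerm ι τ = a)).card := by
    intro a ha
    rw [mem_filter] at ha
    congr 1
    ext τ
    simp only [mem_filter, mem_univ, true_and, mem_goodPerm]
    constructor
    · exact fun h => h.2
    · intro h
      refine ⟨fun k => ?_, h⟩
      have := ha.2 k
      rw [← h] at this
      exact this
  rw [hfib]
  push_cast
  rw [sum_mul, show (((univ : Finset (Fin d ↪ Fin n)).filter
      (fun a => ∀ k, 2 * ((a k : Fin n) : ℕ) ≤ n)).card : ℝ) * n.factorial =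
      ∑ a ∈ (univ : Finset (Fin d ↪ Fin n)).filter (fun a => ∀ k, 2 * ((a k : Fin n) : ℕ) ≤ n),
        (n.factorial : ℝ) from by rw [sum_const, nsmul_eq_mul]]
  refine sum_congr rfl fun a ha => ?_
  rw [hconst a ha]
  exact card_fibre_mul_card ι a

/-- The number of good `d`-tuples is `(m₀)_d`, `m₀ = #goodPos`. [cite: KeevashLifshitz2023, §2.3] -/
theorem card_goodTuples :
    ((univ : Finset (Fin d ↪ Fin n)).filter (fun a => ∀ k, 2 * ((a k : Fin n) : ℕ) ≤ n)).card =
      (goodPos n).card.descFactorial d := by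
  classical
  let T : Type := {j : Fin n // 2 * (j : ℕ) ≤ n}
  have hT : Fintype.card T = (goodPos n).card := by
    rw [Fintype.card_subtype]; rfl
  have key : ((univ : Finset (Fin d ↪ Fin n)).filter (fun a => ∀ k, 2 * ((a k : Fin n) : ℕ) ≤ n)).card =
      Fintype.card (Fin d ↪ T) := by
    rw [← Fintype.card_coe]
    refine Fintype.card_congr ?_
    exact
      { toFun := fun a => ⟨fun k => ⟨a.1 k, (mem_filter.1 a.2).2 k⟩,
          fun k l e => a.1.injective (congr_arg Subtype.val e)⟩
        invFun := fun c => ⟨⟨fun k => (c k).1, fun k l e => c.injective (Subtype.ext e)⟩,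
          mem_filter.2 ⟨mem_univ _, fun k => (c k).2⟩⟩
        left_inv := fun a => by ext k; rfl
        right_inv := fun c => by ext k; rfl }
  rw [key, Fintype.card_embedding_eq, Fintype.card_fin, hT]

/-- `4^d (m₀)_d ≥ (n)_d` when `16 d ≤ n` (each factor: `4(m₀ − k) ≥ n − k`). [cite: KeevashLifshitz2023, §2.3 ("`∏ (n/4 − i)/(n − i) ≥ ½ 4^{−d}`")] -/
theorem descFactorial_goodPos_ge (hd : 16 * d ≤ n) :
    n.descFactorial d ≤ 4 ^ d * (goodPos n).card.descFactorial d := by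
  set m₀ := (goodPos n).card with hm₀
  have hm : ∀ k, k ≤ d → n.descFactorial k ≤ 4 ^ k * m₀.descFactorial k := by
    intro k
    induction k with
    | zero => intro _; simp
    | succ k ih =>
      intro hk
      rw [Nat.descFactorial_succ, Nat.descFactorial_succ, pow_succ]
      have ih' := ih (by omega)
      rcases Nat.eq_zero_or_pos n with h0 | h0
      · subst h0; simp
      have hg := card_goodPos_ge h0
      rw [← hm₀] at hg
      have hstep : n - k ≤ 4 * (m₀ - k) := by omega
      calc (n - k) * n.descFactorial k ≤ (4 * (m₀ - k)) * (4 ^ k * m₀.descFactorial k) :=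
            Nat.mul_le_mul hstep ih'
        _ = 4 ^ k * 4 * ((m₀ - k) * m₀.descFactorial k) := by ring
  exact hm d le_rfl

/-- **Enough good translates**: `n! ≤ 4^d · #goodPerm ι` when `16 d ≤ n`.
[cite: KeevashLifshitz2023, §2.3 ("`P_τ(τ(T) ⊂ [n/4,n/2]) ≥ ½ 4^{−d}`")] -/
theorem card_goodPerm_ge (ι : Fin d ↪ Fin n) (hd : 16 * d ≤ n) :
    (n.factorial : ℝ) ≤ 4 ^ d * ((goodPerm ι).card : ℝ) := by
  have h1 := card_goodPerm_mul ι
  rw [card_goodTuples] at h1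
  have hN : (Fintype.card (Fin d ↪ Fin n) : ℝ) = n.descFactorial d := by
    rw [Fintype.card_embedding_eq, Fintype.card_fin, Fintype.card_fin]
  rw [hN] at h1
  have h2 : (n.descFactorial d : ℝ) ≤ 4 ^ d * ((goodPos n).card.descFactorial d : ℝ) := by
    exact_mod_cast descFactorial_goodPos_ge hd
  have hpos : (0 : ℝ) < n.descFactorial d := by
    have : d ≤ n := by omega
    exact_mod_cast Nat.descFactorial_pos.2 this
  have hfac : (0 : ℝ) ≤ n.factorial := by positivity
  -- `n! · (n)_d ≤ n! · 4^d (m₀)_d = 4^d · (#good · (n)_d)`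
  have := calc (n.factorial : ℝ) * n.descFactorial d
      ≤ n.factorial * (4 ^ d * ((goodPos n).card.descFactorial d : ℝ)) := mul_le_mul_of_nonneg_left h2 hfac
    _ = 4 ^ d * (((goodPerm ι).card : ℝ) * n.descFactorial d) := by rw [h1]; ring
  rw [← mul_assoc] at this
  exact le_of_mul_le_mul_right this hpos

end Literature.Combinatorics.Additive.KeevashLifshitz

end
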